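import Summits.ResolutionOfSingularities.ResolutionOfSingularities.Theorems.FrobeniusLadderFRationalResolutionFRationalLocalizesCore
import Summits.ResolutionOfSingularities.ResolutionOfSingularities.Theorems.FrobeniusLadderFRationalResolutionPrimeAdaptedParameters
import Summits.ResolutionOfSingularities.ResolutionOfSingularities.Theorems.FrobeniusLadderFRationalResolutionSopExtension
import Summits.ResolutionOfSingularities.ResolutionOfSingularities.Theorems.FrobeniusLadderFRationalResolutionFrobeniusPowerUnmixed
import Summits.ResolutionOfSingularities.ResolutionOfSingularities.Theorems.FrobeniusLadderFRationalResolutionMultiplierOffMinimalPrime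
import Summits.ResolutionOfSingularities.ResolutionOfSingularities.Theorems.FrobeniusLadderFRationalResolutionPartialSopTightlyClosed
import Summits.ResolutionOfSingularities.ResolutionOfSingularities.Theorems.FrobeniusLadderFRationalResolutionAtPrimeQuotientPresentation
import Summits.ResolutionOfSingularities.ResolutionOfSingularities.Theorems.FrobeniusLadderFRationalResolutionOneSopStalk
import Summits.ResolutionOfSingularities.ResolutionOfSingularities.Theorems.FrobeniusLadderFRationalResolutionFRationalCM
import Literature.RingTheory.TightClosure.FRationalNormal
import HarnessLib

/-!
# F-rationality localizes (Hochster–Huneke 1994, Thm. 4.2 (f)) for `S/Q` — unconditionally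

Support file for crux stmt-ResolutionOfSingularities-15317 (`FrobeniusLadder.FRationalResolution`),
line `Sketch`, continuation seat c3, cycle 6 (theme LOC). Let `S` be a regular local ring of prime
characteristic `p`, `Q` a prime ideal, and suppose `R = S/Q` satisfies the F-rational clause of
the crux (every ideal generated by a full system of parameters is tightly closed, inline form).
Then for every prime `P` of `R`, EVERY LOCALIZATION `R_P` (any `A` with
`IsLocalization.AtPrime A P`) satisfies the clause as well:

* `exists_tightlyClosed_sop_atPrime` — there are `x₁, …, x_h ∈ P`, `h = ht P = dim R_P`, whose
  images form a system of parameters of `R_P` generating a TIGHTLY CLOSED ideal of `R_P`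
  (parameters adapted to `P`, `…PrimeAdaptedParameters`; extension to a system of parameters of
  `R`, `…SopExtension`, so that `(x)` is tightly closed in `R`, `…PartialSopTightlyClosed`;
  unmixedness of the Frobenius powers `(x^q)`, `…FrobeniusPowerUnmixed`; the uniform multiplier,
  `…MultiplierOffMinimalPrime`; and the core descent `…FRationalLocalizesCore`);
* `fRationalClause_atPrime` — hence, by the one-parameter-ideal criterion (HH94 Prop. 6.27 (a)
  for rings `≃ S'/Q'`, `fRationalClause_of_one_of_ringEquiv_quotient`, applied through the
  presentation `R_P ≃ S_{P̃}/Q S_{P̃}` of `…AtPrimeQuotientPresentation`), `R_P` is a domain all of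
  whose full parameter ideals are tightly closed.

No excellence hypothesis, no test elements: for the rings the route meets (local rings of
varieties and their localizations) HH94 Thm. 4.2 (f) is now a theorem of the tree. Use: the
crux's hypothesis "every stalk is F-rational" is a CLOSED-POINT condition.
[cite: HochsterHuneke1994, Thm. 4.2 (f)]
-/

-- single-problem summit: the doubled namespace component is forced
set_option linter.dupNamespace false

noncomputable section

namespace Summit.ResolutionOfSingularities.ResolutionOfSingularities.Theorems.FRationalResolution

open IsLocalRing Literature.RingTheory.TightClosure Literature.AlgebraicGeometry.Resolution

/-- The first `h` entries of `Fin.append x t` are the entries of `x`. -/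
theorem image_append_Iio_eq_range {α : Type*} {h e : ℕ} (x : Fin h → α) (t : Fin e → α)
    (he : 0 < e) :
    Fin.append x t '' Set.Iio (⟨h, Nat.lt_add_of_pos_right he⟩ : Fin (h + e)) = Set.range x := by
  ext r
  constructor
  · rintro ⟨i, hi, rfl⟩
    have hi' : (i : ℕ) < h := hi
    refine ⟨⟨i, hi'⟩, ?_⟩
    have hii : Fin.castAdd e ⟨i, hi'⟩ = i := Fin.ext rfl
    calc x ⟨i, hi'⟩ = Fin.append x t (Fin.castAdd e ⟨i, hi'⟩) := (Fin.append_left x t _).symm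
      _ = Fin.append x t i := by rw [hii]
  · rintro ⟨j, rfl⟩
    refine ⟨Fin.castAdd e j, ?_, by rw [Fin.append_left]⟩
    show ((Fin.castAdd e j : Fin (h + e)) : ℕ) < h
    simp

/-- With no entries appended, `Fin.append x t` has the same range as `x`. -/
theorem range_append_fin_zero {α : Type*} {h : ℕ} (x : Fin h → α) (t : Fin 0 → α) :
    Set.range (Fin.append x t) = Set.range x := by
  have ht : t = Fin.elim0 := funext fun i => i.elim0
  rw [ht, Fin.append_elim0]
  exact (finCongr (Nat.add_zero h)).surjective.range_comp x

/-- **A tightly closed system of parameters in `R_P` (HH94 Thm. 4.2 (f), constructive half).** Let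
`S` be regular local of characteristic `p`, `Q` prime, `R = S/Q` with every full parameter ideal
tightly closed (inline clause), `P` a prime of `R` and `A = R_P` a localization at `P`. Then there
are `x₁, …, x_h ∈ P` with `dim A = h`, `rad (x) A` maximal, and `(x) A` tightly closed in `A`
(inline form). [cite: HochsterHuneke1994, Thm. 4.2 (f)] -/
theorem exists_tightlyClosed_sop_atPrime (p : ℕ) [Fact p.Prime] (S : Type) [CommRing S]
    [IsRegularLocalRing S] [CharP S p] (Q : Ideal S) [Q.IsPrime]
    (hFR : ∀ d : ℕ, ringKrullDim (S ⧸ Q) = d → ∀ s : Fin d → S ⧸ Q,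
      (Ideal.span (Set.range s)).radical.IsMaximal → ∀ y c : S ⧸ Q, c ≠ 0 →
      (∀ e : ℕ, c * y ^ p ^ e ∈ Ideal.span ((fun z : S ⧸ Q => z ^ p ^ e) ''
        (Ideal.span (Set.range s) : Set (S ⧸ Q)))) → y ∈ Ideal.span (Set.range s))
    (P : Ideal (S ⧸ Q)) [P.IsPrime] (A : Type) [CommRing A] [Algebra (S ⧸ Q) A]
    [IsLocalization.AtPrime A P] :
    ∃ (h : ℕ) (x : Fin h → S ⧸ Q), (∀ i, x i ∈ P) ∧ ringKrullDim A = h ∧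
      (Ideal.span (Set.range fun i => algebraMap (S ⧸ Q) A (x i))).radical.IsMaximal ∧
      ∀ y c : A, c ≠ 0 → (∀ e : ℕ, c * y ^ p ^ e ∈
        Ideal.span ((fun z : A => z ^ p ^ e) ''
          (Ideal.span (Set.range fun i => algebraMap (S ⧸ Q) A (x i)) : Set A))) →
        y ∈ Ideal.span (Set.range fun i => algebraMap (S ⧸ Q) A (x i)) := by
  classical
  -- `R = S/Q`: a Noetherian local domain of characteristic `p`
  haveI : IsDomain S := isDomain_of_isRegularLocalRing S
  have hQtop : Q ≠ ⊤ := ‹Q.IsPrime›.ne_top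
  haveI : Nontrivial (S ⧸ Q) := Ideal.Quotient.nontrivial_iff.mpr hQtop
  haveI : IsDomain (S ⧸ Q) := Ideal.Quotient.isDomain Q
  haveI : IsLocalRing (S ⧸ Q) :=
    IsLocalRing.of_surjective' (Ideal.Quotient.mk Q) Ideal.Quotient.mk_surjective
  haveI : CharP (S ⧸ Q) p := charP_quotient_of_ne_top p Q hQtop
  obtain ⟨d, hd⟩ := exists_ringKrullDim_eq_nat (R := S ⧸ Q)
  have hRfr : IsFRational (S ⧸ Q) p := (isFRational_iff_of_isDomain p).mpr hFR
  -- `h = ht P`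
  obtain ⟨h, hh⟩ := ENat.ne_top_iff_exists.mp (Ideal.height_ne_top ‹P.IsPrime›.ne_top)
  -- parameters adapted to `P`
  obtain ⟨x, hxP, hPmin, hQh⟩ := exists_span_le_prime_minimalPrimes_height (S ⧸ Q) P hh.symm
  -- `h ≤ d`; write `d = h + e'`
  have hhd : h ≤ d := by
    have h1 := Ideal.height_le_ringKrullDim_of_isPrime (I := P)
    rw [← hh, hd] at h1
    exact_mod_cast h1
  obtain ⟨e', rfl⟩ : ∃ e', d = h + e' := ⟨d - h, by omega⟩
  -- extension to a system of parameters of `R`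
  have hItop : Ideal.span (Set.range x) ≠ ⊤ := fun htop =>
    ‹P.IsPrime›.ne_top (top_le_iff.mp (htop ▸ hPmin.1.2))
  obtain ⟨t, hst⟩ := exists_isSystemOfParameters_append_of_height (S ⧸ Q) hd x hQh hItop
  -- `(x)` is tightly closed in `R` (prefix of a system of parameters)
  have htcI : ∀ y c : S ⧸ Q, c ≠ 0 → (∀ e : ℕ, c * y ^ p ^ e ∈
      Ideal.span ((fun z : S ⧸ Q => z ^ p ^ e) '' (Ideal.span (Set.range x) : Set (S ⧸ Q)))) →
      y ∈ Ideal.span (Set.range x) := by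
    rcases Nat.eq_zero_or_pos e' with he0 | hepos
    · subst he0
      have htc := hRfr (Fin.append x t) hst
      rw [range_append_fin_zero] at htc
      exact (isTightlyClosed_iff_of_isDomain p).mp htc
    · have htc := isTightlyClosed_span_image_Iio_of_isFRational p (S ⧸ Q) hRfr (Fin.append x t)
        hst ⟨h, Nat.lt_add_of_pos_right hepos⟩
      rw [image_append_Iio_eq_range x t hepos] at htc
      exact (isTightlyClosed_iff_of_isDomain p).mp htc
  -- unmixedness of the Frobenius powers and the uniform multiplier
  have hcancel : ∀ v : S ⧸ Q, (∀ Q' ∈ (Ideal.span (Set.range x)).minimalPrimes, v ∉ Q') →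
      ∀ (e : ℕ) (w : S ⧸ Q), v * w ∈ Ideal.span (Set.range fun i => x i ^ p ^ e) →
        w ∈ Ideal.span (Set.range fun i => x i ^ p ^ e) :=
    fun v hv e w hw => mem_span_pow_of_mul_mem p S Q hFR x hQh v hv e w hw
  have hmult := exists_multiplier_off_minimalPrime (S ⧸ Q) (Ideal.span (Set.range x)) P hPmin
  refine ⟨h, x, hxP, ?_, radical_span_map_atPrime_isMaximal (S ⧸ Q) P x hPmin hQh A,
    tightlyClosed_span_map_atPrime_of_data p (S ⧸ Q) P x htcI hcancel hmult A⟩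
  -- `dim A = ht P = h`
  rw [IsLocalization.AtPrime.ringKrullDim_eq_height P A, ← hh]
  rfl

/-- **F-rationality localizes (Hochster–Huneke 1994, Thm. 4.2 (f)) for `S/Q`.** Let `S` be a
regular local ring of prime characteristic `p`, `Q` a prime ideal, and suppose every ideal of
`S/Q` generated by a full system of parameters is tightly closed (inline clause of crux
`FRationalResolution`). Then for every prime `P` of `S/Q`, every localization `A = (S/Q)_P` is a
domain all of whose full parameter ideals are tightly closed — the clause holds for `A`.
[cite: HochsterHuneke1994, Thm. 4.2 (f)] -/
theorem fRationalClause_atPrime (p : ℕ) [Fact p.Prime] (S : Type) [CommRing S]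
    [IsRegularLocalRing S] [CharP S p] (Q : Ideal S) [Q.IsPrime]
    (hFR : ∀ d : ℕ, ringKrullDim (S ⧸ Q) = d → ∀ s : Fin d → S ⧸ Q,
      (Ideal.span (Set.range s)).radical.IsMaximal → ∀ y c : S ⧸ Q, c ≠ 0 →
      (∀ e : ℕ, c * y ^ p ^ e ∈ Ideal.span ((fun z : S ⧸ Q => z ^ p ^ e) ''
        (Ideal.span (Set.range s) : Set (S ⧸ Q)))) → y ∈ Ideal.span (Set.range s))
    (P : Ideal (S ⧸ Q)) [P.IsPrime] (A : Type) [CommRing A] [Algebra (S ⧸ Q) A]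
    [IsLocalization.AtPrime A P] :
    IsDomain A ∧ ∀ d : ℕ, ringKrullDim A = d → ∀ s : Fin d → A,
      (Ideal.span (Set.range s)).radical.IsMaximal → ∀ y c : A, c ≠ 0 →
      (∀ e : ℕ, c * y ^ p ^ e ∈ Ideal.span ((fun z : A => z ^ p ^ e) ''
        (Ideal.span (Set.range s) : Set A))) → y ∈ Ideal.span (Set.range s) := by
  obtain ⟨h, x, -, hdim, hrad, htc⟩ := exists_tightlyClosed_sop_atPrime p S Q hFR P A
  obtain ⟨S', _, _, _, Q', hQ', ⟨e⟩⟩ :=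
    exists_atPrime_quotient_ringEquiv_regularLocal_quotient p S Q P A
  haveI := hQ'
  haveI : Nontrivial (S' ⧸ Q') := Ideal.Quotient.nontrivial_iff.mpr hQ'.ne_top
  haveI : IsLocalRing (S' ⧸ Q') :=
    IsLocalRing.of_surjective' (Ideal.Quotient.mk Q') Ideal.Quotient.mk_surjective
  exact fRationalClause_of_one_of_ringEquiv_quotient p Q' e hdim
    (fun i => algebraMap (S ⧸ Q) A (x i)) hrad htc

end Summit.ResolutionOfSingularities.ResolutionOfSingularities.Theorems.FRationalResolution

end
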